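import Literature.Computability.Complexity.NegacyclicFFT
import Literature.Computability.AlgebraicComplexity.BluesteinChirp
import HarnessLib

/-!
# Polynomial products by the negacyclic multiplier: the product tree and Bluestein's values

Literature / complexity toolkit, continuing `NegacyclicFFT.lean` (`negMulRec`, `negMulRec_spec`:
products in `(ℤ/N)[x]/(x^{2^k}+1)`) and `AlgebraicComplexity/BluesteinChirp.lean` (the chirp
identity).  The two polynomial subroutines of Harvey's Algorithm 1 (arXiv:2010.05450, §4;
Lemma 4 = product tree, Lemma 5 = Bluestein) at the list level, as the stack machines will
compute them:

* **plain products from negacyclic ones**: a block in the LOW HALF of exponent `k` (`LowHalf`)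
  is a polynomial of degree `< 2^{k-1}`, so **`negMulRec_mul`**: for two such blocks
  `listPoly (negMulRec N k f g) = listPoly f · listPoly g` exactly (`N` odd `> 1`); padding
  lemma `lowHalf_pad`;
* **the product tree** (`pairsOf`, `ptStep`, `ptRun`, `prodTree`; leaves `linBlock v = x − v`
  at exponent `2`, one exponent more per level, results re-padded), the invariant `PTInv` and
  **`prodTree_spec`**: for `2^e` values the tree ends in ONE block of exponent `e + 2` whose
  polynomial is `∏ (x − v_i)` (`iterate_pairProd`, `prod_pairProd`);
* **Bluestein without inverses**: every chirp factor `g_k = α^{−C(k,2)}` of the source is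
  multiplied by `α^E`, `E = C(n₀+1,2) + C(m,2) ≥` all chirp exponents (`chirpExp_le`), so only
  nonnegative powers of `α` occur and the values come out scaled by the unit `α^E` (harmless
  for the gcds they feed): **`bluestein_eval_shifted`**
  (`α^E Σ_j f_j α^{ij} = α^{C(i,2)} (f'·G')_{i+n₀}`), the lists `chirpF`, `chirpG` (zero-padded
  by `List.rightpad`), `bluesteinValues` and **`bluesteinValues_spec`**: `w_i = α^E · f(α^i)` in `ℤ/N` for `i < m`
  (bridges `listPoly_eq_ofSeq`, `eval_listPoly`).

## References

* D. Harvey, *An exponent one-fifth algorithm for deterministic integer factorisation*,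
  Math. Comp. 90 (2021) 2937–2950, Lemmas 2.3–2.4 (arXiv:2010.05450, Lemmas 4–5). [Harvey2021]
* J. von zur Gathen, J. Gerhard, *Modern Computer Algebra*, 3rd ed., CUP 2013, §10.1 (product
  tree, Lemma 10.4), §8.2–8.3.
* L. I. Bluestein, *A linear filtering approach to the computation of discrete Fourier
  transform*, IEEE Trans. Audio Electroacoust. 18 (1970) 451–455. (All proved here.)
-/

namespace Literature.Computability.Complexity

namespace NegFFT

open _root_.Computability Polynomial

variable (N : ℕ)

/-! ### Plain products from negacyclic products -/

/-- A block sits in the low half of exponent `k`: its entries from position `2^{k-1}` on vanish. [folklore] -/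
def LowHalf (k : ℕ) (f : List ℕ) : Prop := ∀ i, 2 ^ (k - 1) ≤ i → f.getD i 0 = 0

variable {N}

/-- A low-half block is a polynomial of degree `< 2^{k-1}`. [folklore] -/
theorem degree_listPoly_lt_of_lowHalf {k : ℕ} {f : List ℕ} (hf : LowHalf k f) : (listPoly N f).degree < (2 ^ (k - 1) : ℕ) := by
  rw [degree_lt_iff_coeff_zero]
  intro i hi
  rw [coeff_listPoly, hf i (by exact_mod_cast hi), Nat.cast_zero]

/-- **The negacyclic product of low-half blocks is the plain product**: no reduction modulo
`x^{2^k} + 1` takes place (`N` odd `> 1`, `k ≥ 1`). [folklore] -/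
theorem negMulRec_mul (hNodd : Odd N) (hN1 : 1 < N) {k : ℕ} (hk : 1 ≤ k) {f g : List ℕ}
    (hf : BlockOK N (2 ^ k) f) (hg : BlockOK N (2 ^ k) g) (hfl : LowHalf k f) (hgl : LowHalf k g) :
    listPoly N (negMulRec N k f g) = listPoly N f * listPoly N g ∧ BlockOK N (2 ^ k) (negMulRec N k f g) := by
  obtain ⟨hr, hι⟩ := negMulRec_spec hNodd hN1 k hf hg
  refine ⟨eq_of_mk_eq hN1 (L := 2 ^ k) ?_ ?_ ?_, hr⟩
  · simpa [ι, map_mul] using hι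
  · exact (degree_listPoly_lt N _).trans_le (by rw [hr.1])
  · have h2 : (2 ^ k : ℕ) = 2 * 2 ^ (k - 1) := by rw [← pow_succ']; congr 1; omega
    rw [h2]
    exact degree_mul_lt_two_mul (degree_listPoly_lt_of_lowHalf hfl) (degree_listPoly_lt_of_lowHalf hgl)

/-- A padded block of length `2^k` padded by `2^k` zeros is a low-half block of exponent `k+1`. [folklore] -/
theorem lowHalf_pad {k : ℕ} {f : List ℕ} (hf : f.length = 2 ^ k) : LowHalf (k + 1) (f ++ List.replicate (2 ^ k) 0) := by
  intro i hi
  rw [Nat.add_sub_cancel] at hi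
  rw [List.getD_eq_getElem?_getD, List.getElem?_append_right (by omega)]
  by_cases h : i - f.length < 2 ^ k
  · rw [List.getElem?_replicate_of_lt h]; rfl
  · rw [List.getElem?_eq_none (by simp; omega)]; rfl

/-! ### The product tree -/

/-- The leaf block of `x - v`: `[-v, 1, 0, 0]` (exponent `2`). [folklore] -/
def linBlock (v : ℕ) : List ℕ := [negMod N (v % N), 1 % N, 0, 0]

/-- Consecutive pairs of a list (a trailing singleton is dropped). [folklore] -/
def pairsOf {α : Type*} : List α → List (α × α)
  | a :: b :: l => (a, b) :: pairsOf l
  | _ => []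

variable (N)

/-- One level of the product tree at exponent `k`: multiply consecutive pairs, pad to exponent `k+1`. [folklore] -/
def ptStep (k : ℕ) (L : List (List ℕ)) : List (List ℕ) :=
  (pairsOf L).map fun p => negMulRec N k p.1 p.2 ++ List.replicate (2 ^ k) 0

/-- `s` levels of the product tree from exponent `k`. [folklore] -/
def ptRun : ℕ → ℕ → List (List ℕ) → List (List ℕ)
  | _, 0, L => L
  | k, s + 1, L => ptRun (k + 1) s (ptStep N k L)

/-- The product tree of the values `vs` (`2^e` of them): `e` levels from the leaf blocks. [folklore] -/
def prodTree (e : ℕ) (vs : List ℕ) : List (List ℕ) := ptRun N 2 e (vs.map (linBlock (N := N)))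

variable {N}

/-- One level of products of a list of polynomials. [folklore] -/
noncomputable def pairProd {R : Type*} [CommRing R] (Ps : List R[X]) : List R[X] := (pairsOf Ps).map fun p => p.1 * p.2

/-- `pairsOf` of a `map`. [folklore] -/
theorem pairsOf_map {α β : Type*} (f : α → β) : ∀ (l : List α), pairsOf (l.map f) = (pairsOf l).map fun p => (f p.1, f p.2)
  | [] => rfl
  | [_] => rfl
  | a :: b :: l => by rw [List.map_cons, List.map_cons, pairsOf, pairsOf, List.map_cons, pairsOf_map f l]

/-- `pairsOf` has half the length. [folklore] -/
theorem length_pairsOf {α : Type*} : ∀ (l : List α), (pairsOf l).length = l.length / 2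
  | [] => by simp [pairsOf]
  | [_] => by simp [pairsOf]
  | a :: b :: l => by rw [pairsOf, List.length_cons, length_pairsOf l, List.length_cons, List.length_cons]; omega

/-- The members of the pairs are members of the list. [folklore] -/
theorem mem_of_mem_pairsOf {α : Type*} : ∀ (l : List α) (p : α × α), p ∈ pairsOf l → p.1 ∈ l ∧ p.2 ∈ l
  | [], p, hp => by simp [pairsOf] at hp
  | [_], p, hp => by simp [pairsOf] at hp
  | a :: b :: l, p, hp => by
    rw [pairsOf, List.mem_cons] at hp
    rcases hp with rfl | hp
    · simp
    · have := mem_of_mem_pairsOf l p hp; exact ⟨by simp [this.1], by simp [this.2]⟩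

/-- On a list of even length the products of the pairs multiply to the product. [folklore] -/
theorem prod_pairProd {R : Type*} [CommRing R] : ∀ (Ps : List R[X]), 2 ∣ Ps.length → (pairProd Ps).prod = Ps.prod
  | [], _ => rfl
  | [_], h => by simp at h
  | a :: b :: l, h => by
    rw [pairProd, pairsOf, List.map_cons, List.prod_cons, ← pairProd, prod_pairProd l (by simpa [Nat.add_mod] using h),
      List.prod_cons, List.prod_cons, mul_assoc]

/-- Length of `pairProd`. [folklore] -/
theorem length_pairProd {R : Type*} [CommRing R] (Ps : List R[X]) : (pairProd Ps).length = Ps.length / 2 := by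
  rw [pairProd, List.length_map, length_pairsOf]

/-- `e` levels of pair products of `2^e` polynomials leave the single product. [folklore] -/
theorem iterate_pairProd {R : Type*} [CommRing R] : ∀ (e : ℕ) (Ps : List R[X]), Ps.length = 2 ^ e → pairProd^[e] Ps = [Ps.prod]
  | 0, Ps, h => by
    obtain ⟨a, rfl⟩ : ∃ a, Ps = [a] := List.length_eq_one_iff.1 h
    simp
  | e + 1, Ps, h => by
    rw [Function.iterate_succ_apply, iterate_pairProd e (pairProd Ps) (by rw [length_pairProd, h, pow_succ]; simp),
      prod_pairProd Ps (by rw [h, pow_succ]; exact dvd_mul_left _ _)]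

/-- The level invariant: blocks of exponent `k`, valid, low-half, with the given polynomials. [folklore] -/
def PTInv (k : ℕ) (L : List (List ℕ)) (Ps : List (ZMod N)[X]) : Prop :=
  List.Forall₂ (fun b P => BlockOK N (2 ^ k) b ∧ LowHalf k b ∧ listPoly N b = P) L Ps

/-- `Forall₂` passes to consecutive pairs. [folklore] -/
theorem forall₂_pairsOf {α β : Type*} {R : α → β → Prop} : ∀ {l : List α} {l' : List β}, List.Forall₂ R l l' →
    List.Forall₂ (fun p p' => R p.1 p'.1 ∧ R p.2 p'.2) (pairsOf l) (pairsOf l')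
  | [], [], _ => by simp [pairsOf]
  | [_], [_], _ => by simp [pairsOf]
  | a :: b :: l, a' :: b' :: l', h => by
    rw [List.forall₂_cons, List.forall₂_cons] at h
    rw [pairsOf, pairsOf, List.forall₂_cons]
    exact ⟨⟨h.1, h.2.1⟩, forall₂_pairsOf h.2.2⟩

/-- **One level of the product tree** keeps the invariant, with the pair products. [folklore] -/
theorem ptInv_ptStep (hNodd : Odd N) (hN1 : 1 < N) {k : ℕ} (hk : 1 ≤ k) {L : List (List ℕ)} {Ps : List (ZMod N)[X]}
    (h : PTInv k L Ps) : PTInv (k + 1) (ptStep N k L) (pairProd Ps) := by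
  unfold PTInv ptStep pairProd
  rw [List.forall₂_map_left_iff, List.forall₂_map_right_iff]
  refine (forall₂_pairsOf h).imp fun {p p'} hp => ?_
  obtain ⟨⟨hb1, hl1, he1⟩, ⟨hb2, hl2, he2⟩⟩ := hp
  obtain ⟨hmul, hblk⟩ := negMulRec_mul hNodd hN1 hk hb1 hb2 hl1 hl2
  refine ⟨⟨?_, fun a ha => ?_⟩, lowHalf_pad hblk.1, ?_⟩
  · rw [List.length_append, hblk.1, List.length_replicate, pow_succ]; ring
  · rw [List.mem_append] at ha
    rcases ha with ha | ha
    · exact hblk.2 a ha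
    · rw [List.eq_of_mem_replicate ha]; omega
  · rw [listPoly_append_replicate_zero, hmul, he1, he2]

/-- The levels keep the invariant. [folklore] -/
theorem ptInv_ptRun (hNodd : Odd N) (hN1 : 1 < N) : ∀ (s : ℕ) {k : ℕ}, 1 ≤ k → ∀ {L : List (List ℕ)} {Ps : List (ZMod N)[X]},
    PTInv k L Ps → PTInv (k + s) (ptRun N k s L) (pairProd^[s] Ps)
  | 0, _, _, _, _, h => h
  | s + 1, k, hk, L, Ps, h => by
    rw [ptRun, Function.iterate_succ_apply, show k + (s + 1) = k + 1 + s by omega]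
    exact ptInv_ptRun hNodd hN1 s (by omega) (ptInv_ptStep hNodd hN1 hk h)

/-- The leaves satisfy the invariant at exponent `2` with the polynomials `x - v`. [folklore] -/
theorem ptInv_leaves (hN1 : 1 < N) (vs : List ℕ) :
    PTInv 2 (vs.map (linBlock (N := N))) (vs.map fun v : ℕ => X - C (v : ZMod N)) := by
  unfold PTInv
  rw [List.forall₂_map_left_iff, List.forall₂_map_right_iff, List.forall₂_same]
  intro v _
  have hN0 : 0 < N := by omega
  refine ⟨⟨rfl, ?_⟩, ?_, ?_⟩
  · intro a ha
    simp only [linBlock, List.mem_cons, List.not_mem_nil, or_false] at ha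
    rcases ha with rfl | rfl | rfl | rfl
    · exact Nat.mod_lt _ hN0
    · exact Nat.mod_lt _ hN0
    · exact hN0
    · exact hN0
  · intro i hi
    simp only [Nat.add_one_sub_one, pow_one] at hi
    rcases i with _ | _ | _ | _ | i
    · omega
    · omega
    · rfl
    · rfl
    · simp [linBlock]
  · simp only [linBlock, listPoly_cons, listPoly_nil, mul_zero, add_zero, Nat.cast_zero, map_zero]
    rw [natCast_negMod N (Nat.mod_lt _ hN0).le, ZMod.natCast_mod, Nat.mod_eq_of_lt hN1, Nat.cast_one, C_1, C_neg]
    ring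

/-- **The product tree**: for `2^e` values the tree ends in the single block of exponent `e + 2`
(valid, low-half) whose polynomial is `∏ (x - v_i)`. [folklore] -/
theorem prodTree_spec (hNodd : Odd N) (hN1 : 1 < N) {e : ℕ} {vs : List ℕ} (hvs : vs.length = 2 ^ e) :
    ∃ b, prodTree N e vs = [b] ∧ BlockOK N (2 ^ (e + 2)) b ∧ LowHalf (e + 2) b ∧
      listPoly N b = (vs.map fun v : ℕ => X - C (v : ZMod N)).prod := by
  have h := ptInv_ptRun hNodd hN1 e (k := 2) (by norm_num) (ptInv_leaves hN1 vs)
  rw [iterate_pairProd e _ (by rw [List.length_map, hvs]), show 2 + e = e + 2 by omega] at h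
  unfold PTInv at h
  obtain ⟨b, L', hb, hL', heq⟩ := List.forall₂_cons_right_iff.1 h
  rw [List.forall₂_nil_right_iff] at hL'
  subst hL'
  exact ⟨b, heq, hb.1, hb.2.1, hb.2.2⟩

end NegFFT


/-! ## Bluestein's chirp trick without inverses: values on a geometric progression, up to the unit `α^E` -/

namespace NegFFT

open _root_.Computability Polynomial Finset Literature.Computability.AlgebraicComplexity

variable {S : Type*} [CommRing S]

/-- **The shifted chirp identity** (no inverse of `α` needed): with `E ≥` every chirp exponent,
`α^E · Σ_{j≤n} f_j α^{ij} = α^{C(i,2)} · (f' · G')_{i+n}` for `i < m`, where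
`f' = ofSeq (n+1) (α^{C(j+1,2)} f_j)` and `G' = ofSeq (n+m) (α^{E − chirpExp n s})`. [folklore] -/
theorem bluestein_eval_shifted (α : S) (n m E : ℕ) (hE : ∀ s, s < n + m → chirpExp n s ≤ E) (f : ℕ → S) {i : ℕ} (hi : i < m) :
    α ^ E * ∑ j ∈ range (n + 1), f j * α ^ (i * j) =
      α ^ i.choose 2 * (ofSeq (n + 1) (fun j => α ^ (j + 1).choose 2 * f j) *
        ofSeq (n + m) (fun s => α ^ (E - chirpExp n s))).coeff (i + n) := by
  rw [coeff_mul, Nat.sum_antidiagonal_eq_sum_range_succ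
    (fun a b => (ofSeq (n + 1) (fun j => α ^ (j + 1).choose 2 * f j)).coeff a *
      (ofSeq (n + m) (fun s => α ^ (E - chirpExp n s))).coeff b) (i + n),
    ← sum_range_add_sum_Ico _ (show n + 1 ≤ i + n + 1 by omega)]
  have h0 : ∑ j ∈ Ico (n + 1) (i + n + 1),
      (ofSeq (n + 1) (fun j => α ^ (j + 1).choose 2 * f j)).coeff j *
        (ofSeq (n + m) (fun s => α ^ (E - chirpExp n s))).coeff (i + n - j) = 0 := by
    refine sum_eq_zero fun j hj => ?_
    have := (mem_Ico.1 hj).1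
    rw [coeff_ofSeq, if_neg (by omega), zero_mul]
  rw [h0, add_zero, mul_sum, mul_sum]
  refine sum_congr rfl fun j hj => ?_
  have hj' : j ≤ n := Nat.lt_succ_iff.1 (mem_range.1 hj)
  rw [coeff_ofSeq, if_pos (by omega), coeff_ofSeq, if_pos (by omega)]
  have hEs := hE (i + n - j) (by omega)
  have hexp : ∀ c : ℕ, i.choose 2 + (j + 1).choose 2 = i * j + c → chirpExp n (i + n - j) = c →
      α ^ i.choose 2 * (α ^ (j + 1).choose 2 * f j * α ^ (E - chirpExp n (i + n - j))) = α ^ E * (f j * α ^ (i * j)) := by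
    intro c hc hce
    rw [hce] at hEs ⊢
    calc α ^ i.choose 2 * (α ^ (j + 1).choose 2 * f j * α ^ (E - c))
        = f j * α ^ (i.choose 2 + (j + 1).choose 2 + (E - c)) := by rw [pow_add, pow_add]; ring
      _ = f j * α ^ (i * j + E) := by rw [hc, show i * j + c + (E - c) = i * j + E by omega]
      _ = α ^ E * (f j * α ^ (i * j)) := by rw [pow_add]; ring
  by_cases hle : n ≤ i + n - j
  · refine (hexp _ (choose_two_add_choose_two_succ_of_le (by omega)) ?_).symm
    unfold chirpExp; rw [if_pos hle]; congr 1; omega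
  · refine (hexp _ (choose_two_add_choose_two_succ_of_lt (by omega)) ?_).symm
    unfold chirpExp; rw [if_neg hle]; congr 2; omega

/-- The chirp exponents are at most `C(n+1, 2) + C(m, 2)`. [folklore] -/
theorem chirpExp_le (n m s : ℕ) (hs : s < n + m) : chirpExp n s ≤ (n + 1).choose 2 + m.choose 2 := by
  unfold chirpExp
  split_ifs with h
  · exact le_add_left ((Nat.choose_le_choose 2 (by omega)).trans le_rfl)
  · exact le_add_right (Nat.choose_le_choose 2 (by omega))

/-- `listPoly` is `ofSeq` of its entries. [folklore] -/
theorem listPoly_eq_ofSeq (N : ℕ) (l : List ℕ) : listPoly N l = ofSeq l.length (fun j => ((l.getD j 0 : ℕ) : ZMod N)) := by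
  ext i
  rw [coeff_listPoly, coeff_ofSeq]
  split_ifs with h
  · rfl
  · rw [List.getD_eq_default _ _ (by omega), Nat.cast_zero]

/-- Evaluation of a coefficient list at a point is the sum `Σ f_j a^j`. [folklore] -/
theorem eval_listPoly (N : ℕ) (l : List ℕ) (a : ZMod N) :
    (listPoly N l).eval a = ∑ j ∈ range l.length, ((l.getD j 0 : ℕ) : ZMod N) * a ^ j := by
  rw [listPoly_eq_ofSeq, ofSeq, eval_finsetSum]
  simp [eval_mul, eval_pow, eval_X]

/-! ### The values as lists -/

section Lists

variable (N : ℕ)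

/-- The chirped coefficients `f'_j = α^{C(j+1,2)} f_j (mod N)`. [folklore] -/
def chirpF (α : ℕ) (f : List ℕ) : List ℕ := (List.range f.length).map fun j => α ^ (j + 1).choose 2 * f.getD j 0 % N

/-- The shifted chirp sequence `g'_s = α^{E − chirpExp n₀ s} (mod N)`, `s < n₀ + m`. [folklore] -/
def chirpG (α n₀ m E : ℕ) : List ℕ := (List.range (n₀ + m)).map fun s => α ^ (E - chirpExp n₀ s) % N

/-- **Bluestein's values, shifted by the unit `α^E`**: for `f` of length `n₀ + 1` and `m`
points, `E = C(n₀+1,2) + C(m,2)`, one negacyclic product of exponent `k` (with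
`2^{k-1} ≥ n₀ + m`) of the padded `f'` and `g'`, then `w_i = α^{C(i,2)} · (f'g')_{i+n₀}`. [folklore] -/
def bluesteinValues (α m k : ℕ) (f : List ℕ) : List ℕ :=
  (List.range m).map fun i =>
    α ^ i.choose 2 * (negMulRec N k (List.rightpad (2 ^ k) 0 (chirpF N α f))
      (List.rightpad (2 ^ k) 0 (chirpG N α (f.length - 1) m ((f.length - 1 + 1).choose 2 + m.choose 2)))).getD (i + (f.length - 1)) 0 % N

variable {N}

/-- Length of a zero-padded list (`List.rightpad`). [folklore] -/
theorem length_rightpad_of_le {L : ℕ} {l : List ℕ} (h : l.length ≤ L) : (List.rightpad L 0 l).length = L := by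
  rw [List.rightpad, List.length_append, List.length_replicate]; omega

/-- Zero-padding keeps the polynomial. [folklore] -/
theorem listPoly_rightpad (L : ℕ) (l : List ℕ) : listPoly N (List.rightpad L 0 l) = listPoly N l := listPoly_append_replicate_zero l _

/-- A zero-padded short list is a low-half block. [folklore] -/
theorem lowHalf_rightpad {k : ℕ} {l : List ℕ} (h : l.length ≤ 2 ^ (k - 1)) : LowHalf k (List.rightpad (2 ^ k) 0 l) := by
  intro i hi
  rw [List.rightpad, List.getD_eq_getElem?_getD, List.getElem?_append_right (by omega)]
  by_cases h' : i - l.length < 2 ^ k - l.length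
  · rw [List.getElem?_replicate_of_lt h']; rfl
  · rw [List.getElem?_eq_none (by simp; omega)]; rfl

/-- A zero-padded list of residues is a valid block. [folklore] -/
theorem blockOK_rightpad {k : ℕ} {l : List ℕ} (h : l.length ≤ 2 ^ k) (hl : ∀ a ∈ l, a < N) (hN : 0 < N) :
    BlockOK N (2 ^ k) (List.rightpad (2 ^ k) 0 l) := by
  refine ⟨length_rightpad_of_le h, fun a ha => ?_⟩
  rw [List.rightpad, List.mem_append] at ha
  rcases ha with ha | ha
  · exact hl a ha
  · rw [List.eq_of_mem_replicate ha]; exact hN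

/-- The polynomial of the chirped coefficients. [folklore] -/
theorem listPoly_chirpF (α : ℕ) (f : List ℕ) :
    listPoly N (chirpF N α f) = ofSeq f.length (fun j => ((α : ZMod N)) ^ (j + 1).choose 2 * ((f.getD j 0 : ℕ) : ZMod N)) := by
  rw [listPoly_eq_ofSeq]
  have hl : (chirpF N α f).length = f.length := by simp [chirpF]
  rw [hl]
  unfold ofSeq
  refine sum_congr rfl fun j hj => ?_
  rw [mem_range] at hj
  have : (chirpF N α f).getD j 0 = α ^ (j + 1).choose 2 * f.getD j 0 % N := by
    rw [chirpF, List.getD_eq_getElem?_getD, List.getElem?_map, List.getElem?_range hj]; rfl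
  simp only [this, ZMod.natCast_mod, Nat.cast_mul, Nat.cast_pow]

/-- The polynomial of the shifted chirp sequence. [folklore] -/
theorem listPoly_chirpG (α n₀ m E : ℕ) :
    listPoly N (chirpG N α n₀ m E) = ofSeq (n₀ + m) (fun s => ((α : ZMod N)) ^ (E - chirpExp n₀ s)) := by
  rw [listPoly_eq_ofSeq]
  have hl : (chirpG N α n₀ m E).length = n₀ + m := by simp [chirpG]
  rw [hl]
  unfold ofSeq
  refine sum_congr rfl fun s hs => ?_
  rw [mem_range] at hs
  have : (chirpG N α n₀ m E).getD s 0 = α ^ (E - chirpExp n₀ s) % N := by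
    rw [chirpG, List.getD_eq_getElem?_getD, List.getElem?_map, List.getElem?_range hs]; rfl
  simp only [this, ZMod.natCast_mod, Nat.cast_pow]

/-- **Correctness of the shifted Bluestein values**: for `N` odd `> 1`, `f = (f_0, …, f_{n₀})`
nonempty with reduced entries, `m ≥ 1` points, exponent `k ≥ 1` with `2^{k-1} ≥ n₀ + m`:
`w_i = α^E · f(α^i)` in `ℤ/N` for every `i < m`, where `E = C(n₀+1,2) + C(m,2)`. [folklore] -/
theorem bluesteinValues_spec (hNodd : Odd N) (hN1 : 1 < N) {α m k : ℕ} {f : List ℕ} (hf : f ≠ [])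
    (hk : 1 ≤ k) (hkm : f.length - 1 + m ≤ 2 ^ (k - 1)) {i : ℕ} (hi : i < m) :
    (((bluesteinValues N α m k f).getD i 0 : ℕ) : ZMod N) =
      (α : ZMod N) ^ ((f.length - 1 + 1).choose 2 + m.choose 2) * (listPoly N f).eval ((α : ZMod N) ^ i) := by
  have hN0 : 0 < N := by omega
  set n₀ := f.length - 1 with hn₀
  have hfl : f.length = n₀ + 1 := by
    have : 0 < f.length := List.length_pos_iff.2 hf
    omega
  set E := (n₀ + 1).choose 2 + m.choose 2 with hE
  have h2k : 2 ^ (k - 1) ≤ 2 ^ k := Nat.pow_le_pow_right (by norm_num) (by omega)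
  have hFl : (chirpF N α f).length ≤ 2 ^ (k - 1) := by simp [chirpF]; omega
  have hGl : (chirpG N α n₀ m E).length ≤ 2 ^ (k - 1) := by simp [chirpG]; omega
  have hFv : ∀ a ∈ chirpF N α f, a < N := fun a ha => by
    simp only [chirpF, List.mem_map, List.mem_range] at ha; obtain ⟨j, -, rfl⟩ := ha; exact Nat.mod_lt _ hN0
  have hGv : ∀ a ∈ chirpG N α n₀ m E, a < N := fun a ha => by
    simp only [chirpG, List.mem_map, List.mem_range] at ha; obtain ⟨j, -, rfl⟩ := ha; exact Nat.mod_lt _ hN0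
  obtain ⟨hmul, hblk⟩ := negMulRec_mul hNodd hN1 hk (blockOK_rightpad (hFl.trans h2k) hFv hN0) (blockOK_rightpad (hGl.trans h2k) hGv hN0)
    (lowHalf_rightpad hFl) (lowHalf_rightpad hGl)
  rw [listPoly_rightpad, listPoly_rightpad, listPoly_chirpF, listPoly_chirpG, hfl] at hmul
  -- the value
  have hget : (bluesteinValues N α m k f).getD i 0 =
      α ^ i.choose 2 * (negMulRec N k (List.rightpad (2 ^ k) 0 (chirpF N α f)) (List.rightpad (2 ^ k) 0 (chirpG N α n₀ m E))).getD (i + n₀) 0 % N := by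
    rw [bluesteinValues, List.getD_eq_getElem?_getD, List.getElem?_map, List.getElem?_range hi]; rfl
  rw [hget, ZMod.natCast_mod, Nat.cast_mul, Nat.cast_pow, ← coeff_listPoly, hmul,
    ← bluestein_eval_shifted (α : ZMod N) n₀ m E (fun s hs => chirpExp_le n₀ m s hs) (fun j => ((f.getD j 0 : ℕ) : ZMod N)) hi,
    eval_listPoly, hfl]
  congr 1
  refine sum_congr rfl fun j _ => ?_
  rw [← pow_mul]

end Lists

end NegFFT

end Literature.Computability.Complexity
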